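import Summits.Langlands.Langlands.Theses.SqrtFiveQuarticCovers
import Literature.NumberTheory.Automorphic.TotallyRealModularitySmallImage
import HarnessLib

/-!
# Route `SqrtFiveQuarticCovers`, crux `BoxBorelFive` (stmt-Langlands-17835), line `birth`:
# the registered stub `stub_quarticJ` modulo Box 2022 Thm. 1.5 (+ 1.4), and from the crux itself

The stub `stub_quarticJ` of `Cruxes/BoxBorelFive/Lines/birth.lean` is the crux `BoxBorelFive` with the
extra hypothesis `2 < deg (minpoly_ℚ j(E))` (the quartic-`j` half of the skeleton's split by
`j`-degree): for `K` totally real quartic with `√5 ∈ K` and `E / 𝓞 K` (`Δ ≠ 0`) whose mod-`3` image is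
Borel or in `C_s⁺(3)`, mod-`5` image Borel, mod-`7` image Borel or in `G(e7)` (some framing each),
`E` is modular in the route's written-out sense.

* `stub_quarticJ_of_Box2022_theorem1_5_modular` — from the named fact `Box2022_theorem1_5_modular`
  (Box 2022, Thm. 1.5 with Thm. 1.4: the quartic points of the four `b5` curves are modular), exactly
  as the tree's crux-level `BoxBorelFive_of_Box2022_theorem1_5_modular` (p647780): the `√5` and
  `j`-degree hypotheses are idle;
* `stub_quarticJ_of_boxBorelFive` — from the crux decl `BoxBorelFive` (the stub is its
  specialisation; pure logic), so the stub carries no content beyond the crux item.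

HONEST STATUS: CONDITIONAL (a named automorphy fact, resp. the open crux, as hypothesis); closes the
stub by name in neither form; proves modularity of no curve.  Helper of stmt-Langlands-17835.

References: [Box2022] J. Box, Trans. AMS 375 (2022), Thms. 1.4, 1.5, §1.1–1.2.
-/

set_option linter.dupNamespace false -- project-wide option; `Summit.Langlands.Langlands` is the mandated namespace

noncomputable section

namespace Summit.Langlands.Langlands.Theorems.SqrtFiveQuarticCovers

open scoped NumberField Matrix
open NumberField Literature.NumberTheory.Automorphic Summit.Langlands.Langlands.Theses.SqrtFiveQuarticCovers

/-- **Registered stub `stub_quarticJ` (line `birth`, stmt-Langlands-17835) modulo Box 2022 Thm. 1.5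
(+ Thm. 1.4)**: the named fact `Box2022_theorem1_5_modular` gives `IsAutomorphicOfWeightZero E` for
every totally real quartic `K` under the three image hypotheses; `.isHilbertModular` and
`IsHilbertModular.isModularEllipticCurve` translate it into the written-out cone.  The hypotheses
`√5 ∈ K` and `2 < deg minpoly_ℚ j` are not used.  Conclusion = the registered signature verbatim.
[cite: Box2022, Thm. 1.5 and Thm. 1.4] -/
theorem stub_quarticJ_of_Box2022_theorem1_5_modular (h : Box2022_theorem1_5_modular) :
    ∀ (K : Type) [Field K] [NumberField K], NumberField.IsTotallyReal K → Module.finrank ℚ K = 4 → (∃ r : K, r ^ 2 = 5) → ∀ E : WeierstrassCurve (NumberField.RingOfIntegers K), E.Δ ≠ 0 → 2 < (minpoly ℚ ((E.baseChange K).c₄ ^ 3 / (E.baseChange K).Δ)).natDegree → (∃ ρ : Literature.NumberTheory.GaloisRepresentations.FramedGaloisRep K (ZMod 3) 2, (∃ e : (E.baseChange K).geomTorsion ((3 : ℕ) : ℤ) ≃+ (Fin 2 → ZMod 3), ∀ (σ : Field.absoluteGaloisGroup K) (P : (E.baseChange K).geomTorsion ((3 : ℕ) : ℤ)), e (σ •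 P) = ((ρ σ : GL (Fin 2) (ZMod 3)) : Matrix (Fin 2) (Fin 2) (ZMod 3)) *ᵥ (e P)) ∧ ((∀ σ : Field.absoluteGaloisGroup K, (((ρ σ : GL (Fin 2) (ZMod 3)) : Matrix (Fin 2) (Fin 2) (ZMod 3)) 1 0 = 0)) ∨ (∀ σ : Field.absoluteGaloisGroup K, (ρ σ : GL (Fin 2) (ZMod 3)) ∈ Subgroup.closure ({(⟨!![1, 0; 0, 2], !![1, 0; 0, 2], by decide, by decide⟩ : GL (Fin 2) (ZMod 3)), (⟨!![0, 1; 1, 0], !![0, 1; 1, 0], by decide, by decide⟩ : GL (Fin 2) (ZMod 3))} : Set (GL (Fin 2) (ZMod 3)))))) → (∃ ρ : Literature.NumberTheory.GaloisRepresentations.FramedGaloisRep K (ZMod 5) 2, (∃ e : (E.baseChange K).geomTorsion ((5 : ℕ) : ℤ) ≃+ (Fin 2 → ZMod 5), ∀ (σ : Field.absoluteGaloisGroup K) (P : (E.baseChange K).geomTorsion ((5 : ℕ) : ℤ)), e (σ • P) = ((ρ σ : GL (Fin 2) (ZMod 5)) : Matrix (Fin 2) (Fin 2) (ZMod 5)) *ᵥ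 (e P)) ∧ (∀ σ : Field.absoluteGaloisGroup K, (((ρ σ : GL (Fin 2) (ZMod 5)) : Matrix (Fin 2) (Fin 2) (ZMod 5)) 1 0 = 0))) → (∃ ρ : Literature.NumberTheory.GaloisRepresentations.FramedGaloisRep K (ZMod 7) 2, (∃ e : (E.baseChange K).geomTorsion ((7 : ℕ) : ℤ) ≃+ (Fin 2 → ZMod 7), ∀ (σ : Field.absoluteGaloisGroup K) (P : (E.baseChange K).geomTorsion ((7 : ℕ) : ℤ)), e (σ • P) = ((ρ σ : GL (Fin 2) (ZMod 7)) : Matrix (Fin 2) (Fin 2) (ZMod 7)) *ᵥ (e P)) ∧ ((∀ σ : Field.absoluteGaloisGroup K, (((ρ σ : GL (Fin 2) (ZMod 7)) : Matrix (Fin 2) (Fin 2) (ZMod 7)) 1 0 = 0)) ∨ (∀ σ : Field.absoluteGaloisGroup K, (ρ σ : GL (Fin 2) (ZMod 7)) ∈ Subgroup.closure ({(⟨!![0, 5; 3, 0], !![0, 5; 3, 0], by decide, by decide⟩ : GL (Fin 2) (ZMod 7)), (⟨!![5, 0; 3, 2], !![3, 0; 6, 4], by decide, by decide⟩ : GL (Fin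 2) (ZMod 7))} : Set (GL (Fin 2) (ZMod 7)))))) → ((E.baseChange K).HasCM ∨ ∃ (hF : Literature.NumberTheory.Automorphic.isCompact_glFiniteIntegralLevel 2 K) (π : Literature.NumberTheory.Automorphic.CuspidalAutomorphicRepData 2 K hF), π.1.HasWeightZero ∧ ∀ᶠ w : IsDedekindDomain.HeightOneSpectrum (NumberField.RingOfIntegers K) in Filter.cofinite, ∃ α : Multiset ℂ, π.1.HasSatakeParamAt w α ∧ ((Real.sqrt w.residueCard : ℝ) : ℂ) * α.sum = (Literature.NumberTheory.Automorphic.frobTraceAt E w : ℂ)) := by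
  intro K _ _ hK hd _h5 E hE _hdeg h3 hb5 h7
  haveI : IsTotallyReal K := hK
  exact (Box2022_theorem1_5_modular.isHilbertModular h K hd hE h3 hb5 h7).isModularEllipticCurve

/-- **Registered stub `stub_quarticJ` from the crux `BoxBorelFive` itself** (the stub is the crux
with one more hypothesis): pure logic, recorded so that the ledger sees the stub carries no content
beyond the crux item stmt-Langlands-17835. [cite: Box2022, Thm. 1.5] -/
theorem stub_quarticJ_of_boxBorelFive (h : BoxBorelFive) :
    ∀ (K : Type) [Field K] [NumberField K], NumberField.IsTotallyReal K → Module.finrank ℚ K = 4 → (∃ r : K, r ^ 2 = 5) → ∀ E : WeierstrassCurve (NumberField.RingOfIntegers K), E.Δ ≠ 0 → 2 < (minpoly ℚ ((E.baseChange K).c₄ ^ 3 / (E.baseChange K).Δ)).natDegree → (∃ ρ : Literature.NumberTheory.GaloisRepresentations.FramedGaloisRep K (ZMod 3) 2, (∃ e : (E.baseChange K).geomTorsion ((3 : ℕ) : ℤ) ≃+ (Fin 2 → ZMod 3), ∀ (σ : Field.absoluteGaloisGroup K) (P : (E.baseChange K).geomTorsion ((3 : ℕ) : ℤ)), e (σ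 • P) = ((ρ σ : GL (Fin 2) (ZMod 3)) : Matrix (Fin 2) (Fin 2) (ZMod 3)) *ᵥ (e P)) ∧ ((∀ σ : Field.absoluteGaloisGroup K, (((ρ σ : GL (Fin 2) (ZMod 3)) : Matrix (Fin 2) (Fin 2) (ZMod 3)) 1 0 = 0)) ∨ (∀ σ : Field.absoluteGaloisGroup K, (ρ σ : GL (Fin 2) (ZMod 3)) ∈ Subgroup.closure ({(⟨!![1, 0; 0, 2], !![1, 0; 0, 2], by decide, by decide⟩ : GL (Fin 2) (ZMod 3)), (⟨!![0, 1; 1, 0], !![0, 1; 1, 0], by decide, by decide⟩ : GL (Fin 2) (ZMod 3))} : Set (GL (Fin 2) (ZMod 3)))))) → (∃ ρ : Literature.NumberTheory.GaloisRepresentations.FramedGaloisRep K (ZMod 5) 2, (∃ e : (E.baseChange K).geomTorsion ((5 : ℕ) : ℤ) ≃+ (Fin 2 → ZMod 5), ∀ (σ : Field.absoluteGaloisGroup K) (P : (E.baseChange K).geomTorsion ((5 : ℕ) : ℤ)), e (σ • P) = ((ρ σ : GL (Fin 2) (ZMod 5)) : Matrix (Fin 2) (Fin 2) (ZMod 5))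 *ᵥ (e P)) ∧ (∀ σ : Field.absoluteGaloisGroup K, (((ρ σ : GL (Fin 2) (ZMod 5)) : Matrix (Fin 2) (Fin 2) (ZMod 5)) 1 0 = 0))) → (∃ ρ : Literature.NumberTheory.GaloisRepresentations.FramedGaloisRep K (ZMod 7) 2, (∃ e : (E.baseChange K).geomTorsion ((7 : ℕ) : ℤ) ≃+ (Fin 2 → ZMod 7), ∀ (σ : Field.absoluteGaloisGroup K) (P : (E.baseChange K).geomTorsion ((7 : ℕ) : ℤ)), e (σ • P) = ((ρ σ : GL (Fin 2) (ZMod 7)) : Matrix (Fin 2) (Fin 2) (ZMod 7)) *ᵥ (e P)) ∧ ((∀ σ : Field.absoluteGaloisGroup K, (((ρ σ : GL (Fin 2) (ZMod 7)) : Matrix (Fin 2) (Fin 2) (ZMod 7)) 1 0 = 0)) ∨ (∀ σ : Field.absoluteGaloisGroup K, (ρ σ : GL (Fin 2) (ZMod 7)) ∈ Subgroup.closure ({(⟨!![0, 5; 3, 0], !![0, 5; 3, 0], by decide, by decide⟩ : GL (Fin 2) (ZMod 7)), (⟨!![5, 0; 3, 2], !![3, 0; 6, 4], by decide, by decide⟩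 : GL (Fin 2) (ZMod 7))} : Set (GL (Fin 2) (ZMod 7)))))) → ((E.baseChange K).HasCM ∨ ∃ (hF : Literature.NumberTheory.Automorphic.isCompact_glFiniteIntegralLevel 2 K) (π : Literature.NumberTheory.Automorphic.CuspidalAutomorphicRepData 2 K hF), π.1.HasWeightZero ∧ ∀ᶠ w : IsDedekindDomain.HeightOneSpectrum (NumberField.RingOfIntegers K) in Filter.cofinite, ∃ α : Multiset ℂ, π.1.HasSatakeParamAt w α ∧ ((Real.sqrt w.residueCard : ℝ) : ℂ) * α.sum = (Literature.NumberTheory.Automorphic.frobTraceAt E w : ℂ)) := by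
  intro K _ _ hK hd h5 E hE _hdeg h3 hb5 h7
  exact h K hK hd h5 E hE h3 hb5 h7

end Summit.Langlands.Langlands.Theorems.SqrtFiveQuarticCovers

end
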